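/-
Copyright (c) 2026 the pub-hodgecm-mathlib formalisation cell (harness21).  Prover seat hodgecm-mathlib-K2E1-p16 (g2), Track B «K2-LIT» ENGINE E1, h413 = `stmt-HodgeConjecture-24833`,
route `HCCMUnconditional`, R90-TF S8; deal S8-R137 (d) (S8 dealer R90-CS-plan (g3)): F3′ — the NONEMPTY-INDEX edition of the #3 seam ★ `R90S8ResGTransportOfQuasiSplitU3` §2.
-/
import Summits.HodgeConjecture.HodgeConjecture.Theorems.R90S8ResGTransportOfQuasiSplitU3   -- ★ F3 (R90-C14-p02): `resG_piN_occurs_of_eq`, `resG_piN_occurs_of_quasiSplit`, the `subst` seam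
import HarnessLib

/-!
# S8 #3-road — `R90S8ResGTransportOfQuasiSplitNonemptyU3` (F3′): THE #3 SEAM WITH THE QUASISPLIT HYPOTHESIS ASKED ONLY FOR NONEMPTY PARABOLIC INDEX

Track B ∕ K2-LIT, crux h413 = `stmt-HodgeConjecture-24833`, route of record `HCCMUnconditional`; cell `hodgecm-mathlib`, R90-TF S8; S8 dealer R90-CS-plan (g3) ruling S8-R137
(FLAG ① of K2E1-p12 (g5)'s (R)-assembly census 3ab46e86a8764769).  THEOREMS ONLY (no `def`, no `instance`, no `notation`, no named-fact hypothesis, no `sorry`; default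
heartbeats); lane `--supports stmt-HodgeConjecture-24833 --as helper` (count-neutral).  CLOSES NO SOCKET.

WHY ([Rogawski1990, §13.9 p. 229 (ii)]; harness hygiene).  ★ F3 `resG_piN_occurs_of_quasiSplit` takes the quasiSplit-side existence statement `H` for EVERY parabolic-unipotent
datum `𝔓` whose radicals are the Heisenberg `N(𝔸)`, including data with EMPTY index `𝔓.ι = ∅`; there the family of constant-term conditions is empty and the residual subspace
`residualSubspace … 𝔓` may well be `⊥`, making that instance of `H` false — so a socket (R) stated in `H`'s shape would be MISSTATED at empty index (audit pending, S8-R137).  The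
repair of record is the (R)′ shape: quantify `H` additionally over `(hne : Nonempty 𝔓.ι)`.  This file is the matching seam: **`resG_piN_occurs_of_eq_of_nonempty`** (the `J`-generic
transport, `subst` device of ★ F3 verbatim) and **`resG_piN_occurs_of_quasiSplit_of_nonempty`** — SAME CONCLUSION BYTES as ★ F3 (:261–:267: literal `Φ₃`, `IsPiN`,
`cmResidualSubspaceR L 3`), because the record datum `cmParabolicDataR L 3` has index `{k ∕∕ 1 ≤ k ∧ 2k ≤ 3} = {1}`, nonempty by the witness `⟨1, _, _⟩`.  B ED. 7 (typ2's pen)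
then pays #3 by `exact resG_piN_occurs_of_quasiSplit_of_nonempty ‹(R)′›`.
HONEST LABEL: HC_CM is proved only modulo the 7 printed citations (2 remaining named inputs: hLiu418 = `stmt-HodgeConjecture-24832`, h413 = `stmt-HodgeConjecture-24833`) until rung 0
closes; this file asserts no named fact, closes no socket, and is count-neutral; the quasiSplit-side statement stays an explicit ∀-hypothesis.

## References
* [Rogawski1990] J. D. Rogawski, *Automorphic Representations of Unitary Groups in Three Variables*, Ann. of Math. Stud. 123 (1990), §13.9 p. 229 (ii), Thm. 13.3.6 (a).
-/

set_option autoImplicit false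
-- the mandated namespace repeats the single-problem summit's segment (`HodgeConjecture.HodgeConjecture`)
set_option linter.dupNamespace false

noncomputable section

open MeasureTheory NumberField IsDedekindDomain
open scoped Matrix
open Literature.NumberTheory.GaloisRepresentations Literature.NumberTheory.Automorphic.Arthur2013.Leaves.TECR
open Literature.NumberTheory.Automorphic Literature.NumberTheory.Automorphic.UnitaryGroup Literature.NumberTheory.Rogawski1990
open Summit.HodgeConjecture.HodgeConjecture.Cruxes.H413.K2E1CuspidalSpectrumUnitary
open Summit.HodgeConjecture.HodgeConjecture.Cruxes.H413.R90S8ResidualDefs (IsPiN)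
open Summit.HodgeConjecture.HodgeConjecture.Cruxes.H413.K2E1HeckeLHalfNeZeroDefs (LHalfNeZero)
open Summit.HodgeConjecture.HodgeConjecture.Cruxes.H413.K2E1HeisenbergRadicalCocompactU3 (upperUnitriangular_eq_flagUnipotentRadical_three)

namespace Summit.HodgeConjecture.HodgeConjecture.R90.S8

/-- **Step 1 of the seam for #3, NONEMPTY-INDEX EDITION (F3′)**: ★ `resG_piN_occurs_of_eq` with the quasiSplit-side hypothesis `H` quantified ADDITIONALLY over
`(hne : Nonempty 𝔓.ι)` (right after the radical clause — the (R)′ shape ruled in S8-R137: at `𝔓.ι = ∅` an empty family of constant-term conditions may make `residualSubspace … 𝔓 = ⊥`,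
so the honest existence statement is asked only for nonempty index), and the matching outer binder `hne`; transported to `U(J)` for any `J` with `(antidiagonal 3).over L = J` by
`subst` exactly as in ★ F3. [cite: Rogawski1990, §13.9 p. 229 (ii)] [cite: Rogawski1990, Thm. 13.3.6 (a) p. 202] -/
theorem resG_piN_occurs_of_eq_of_nonempty {L : Type} [Field L] [NumberField L] [IsCMField L]
    (H : ∀ (μ : Measure (quasiSplit (↥(maximalRealSubfield L)) L (IsCMField.complexConj L) 3).automorphicQuotient)
      [(quasiSplit (↥(maximalRealSubfield L)) L (IsCMField.complexConj L) 3).IsAutomorphicMeasure μ]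
      (𝔓 : (quasiSplit (↥(maximalRealSubfield L)) L (IsCMField.complexConj L) 3).ParabolicUnipotentData)
      (_ : ∀ j : 𝔓.ι, 𝔓.radical j = adelicUnipotent (↥(maximalRealSubfield L)) L (IsCMField.complexConj L) 3) (_ : Nonempty 𝔓.ι)
      (μω : HeckeCharacter L) (hμu : μω.IsUnitary),
      (∀ x : Literature.NumberTheory.GaloisRepresentations.ideleGroup ↥(maximalRealSubfield L),
        μω (AdeleRing.ideleBaseChange (↥(maximalRealSubfield L)) L x) = quadraticHeckeCharCM L x) →
      ∀ (ξ : OneDimAutRepH L), LHalfNeZero (ξ.bcη⁻¹ * μω) →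
        ∃ P : DiscreteAutomorphicRep (quasiSplit (↥(maximalRealSubfield L)) L (IsCMField.complexConj L) 3) μ,
          (∃ Pv : ∀ v : HeightOneSpectrum (𝓞 ↥(maximalRealSubfield L)), CMLocalAPacket L ((StdForm.antidiagonal 3).over L) v,
            ξ.IsXiLocalFamily (UnitaryGroup.cmConj_antidiagonal_transpose L 3)
                ((Matrix.isUnit_iff_isUnit_det _).mp (StdForm.isUnit_over (StdForm.antidiagonal 3) L)) μω hμu Pv ∧
            LocalConstituentsIn P Pv ∧
            ∀ v : HeightOneSpectrum (𝓞 ↥(maximalRealSubfield L)),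
              (∀ w : PlacesOver L v, IsCMField.complexConj L • w.1 = w.1) →
              ∀ c : IrrClass ((quasiSplit (↥(maximalRealSubfield L)) L (IsCMField.complexConj L) 3).Local v), c ∈ (Pv v).members →
                ¬ c.IsSupercuspidal ∧
                ∀ [MeasurableSpace ((quasiSplit (↥(maximalRealSubfield L)) L (IsCMField.complexConj L) 3).Local v ⧸
                      Subgroup.center ((quasiSplit (↥(maximalRealSubfield L)) L (IsCMField.complexConj L) 3).Local v))]
                  [BorelSpace ((quasiSplit (↥(maximalRealSubfield L)) L (IsCMField.complexConj L) 3).Local v ⧸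
                      Subgroup.center ((quasiSplit (↥(maximalRealSubfield L)) L (IsCMField.complexConj L) 3).Local v))]
                  (μZ : Measure ((quasiSplit (↥(maximalRealSubfield L)) L (IsCMField.complexConj L) 3).Local v ⧸
                      Subgroup.center ((quasiSplit (↥(maximalRealSubfield L)) L (IsCMField.complexConj L) 3).Local v)))
                  [μZ.IsHaarMeasure], ¬ c.IsSquareIntegrable μZ) ∧
          P.space ≤ residualSubspace (quasiSplit (↥(maximalRealSubfield L)) L (IsCMField.complexConj L) 3) μ 𝔓)
    {J : Matrix (Fin 3) (Fin 3) L} (hJ : (StdForm.antidiagonal 3).over L = J) (hJh : (J.map (cmConjRingHom L))ᵀ = J) (hJu : IsUnit J.det)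
    (μ : Measure (adelicGroupData (↥(maximalRealSubfield L)) L (IsCMField.complexConj L) 3 J).automorphicQuotient)
    [(adelicGroupData (↥(maximalRealSubfield L)) L (IsCMField.complexConj L) 3 J).IsAutomorphicMeasure μ]
    (𝔓 : (adelicGroupData (↥(maximalRealSubfield L)) L (IsCMField.complexConj L) 3 J).ParabolicUnipotentData)
    (h𝔓 : ∀ j : 𝔓.ι, 𝔓.radical j =
      (flagUnipotentRadical 3 1 (AdeleRing (𝓞 L) L)).comap (adelicVal (↥(maximalRealSubfield L)) L (IsCMField.complexConj L) 3 J))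
    (hne : Nonempty 𝔓.ι) (μω : HeckeCharacter L) (hμu : μω.IsUnitary)
    (hμω : ∀ x : Literature.NumberTheory.GaloisRepresentations.ideleGroup ↥(maximalRealSubfield L),
      μω (AdeleRing.ideleBaseChange (↥(maximalRealSubfield L)) L x) = quadraticHeckeCharCM L x)
    (ξ : OneDimAutRepH L) (hL : LHalfNeZero (ξ.bcη⁻¹ * μω)) :
    ∃ P : DiscreteAutomorphicRep (adelicGroupData (↥(maximalRealSubfield L)) L (IsCMField.complexConj L) 3 J) μ,
      (∃ Pv : ∀ v : HeightOneSpectrum (𝓞 ↥(maximalRealSubfield L)), CMLocalAPacket L J v,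
        ξ.IsXiLocalFamily hJh hJu μω hμu Pv ∧
        LocalConstituentsIn P Pv ∧
        ∀ v : HeightOneSpectrum (𝓞 ↥(maximalRealSubfield L)),
          (∀ w : PlacesOver L v, IsCMField.complexConj L • w.1 = w.1) →
          ∀ c : IrrClass ((UnitaryGroup.cmDatum L 3 J).Local v), c ∈ (Pv v).members →
            ¬ c.IsSupercuspidal ∧
            ∀ [MeasurableSpace ((UnitaryGroup.cmDatum L 3 J).Local v ⧸ Subgroup.center ((UnitaryGroup.cmDatum L 3 J).Local v))]
              [BorelSpace ((UnitaryGroup.cmDatum L 3 J).Local v ⧸ Subgroup.center ((UnitaryGroup.cmDatum L 3 J).Local v))]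
              (μZ : Measure ((UnitaryGroup.cmDatum L 3 J).Local v ⧸ Subgroup.center ((UnitaryGroup.cmDatum L 3 J).Local v)))
              [μZ.IsHaarMeasure], ¬ c.IsSquareIntegrable μZ) ∧
      P.space ≤ residualSubspace (adelicGroupData (↥(maximalRealSubfield L)) L (IsCMField.complexConj L) 3 J) μ 𝔓 := by
  subst hJ
  have h𝔓' : ∀ j : 𝔓.ι, 𝔓.radical j = adelicUnipotent (↥(maximalRealSubfield L)) L (IsCMField.complexConj L) 3 := fun j => by
    rw [h𝔓 j]
    show _ = (upperUnitriangular (Fin 3) (AdeleRing (𝓞 L) L)).comap _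
    rw [upperUnitriangular_eq_flagUnipotentRadical_three]
  exact H μ 𝔓 h𝔓' hne μω hμu hμω ξ hL

/-- **THE JUNCTION for #3, NONEMPTY-INDEX EDITION (F3′)** — the quasiSplit existence statement for every CM field, asked only for parabolic data with NONEMPTY index, still
yields socket #3's EXACT type (conclusion bytes ≡ ★ `resG_piN_occurs_of_quasiSplit`): the record datum `cmParabolicDataR L 3` has index `{k ∕∕ 1 ≤ k ∧ 2k ≤ 3} ∋ 1`, witness
`⟨1, _, _⟩`.  B ED. 7 pays #3 by `exact resG_piN_occurs_of_quasiSplit_of_nonempty ‹(R)′-shaped statement›`. [cite: Rogawski1990, §13.9 p. 229 (ii)]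
[cite: Rogawski1990, Thm. 13.3.6 (a) p. 202] -/
theorem resG_piN_occurs_of_quasiSplit_of_nonempty
    (H : ∀ (L : Type) [Field L] [NumberField L] [IsCMField L]
      (μ : Measure (quasiSplit (↥(maximalRealSubfield L)) L (IsCMField.complexConj L) 3).automorphicQuotient)
      [(quasiSplit (↥(maximalRealSubfield L)) L (IsCMField.complexConj L) 3).IsAutomorphicMeasure μ]
      (𝔓 : (quasiSplit (↥(maximalRealSubfield L)) L (IsCMField.complexConj L) 3).ParabolicUnipotentData)
      (_ : ∀ j : 𝔓.ι, 𝔓.radical j = adelicUnipotent (↥(maximalRealSubfield L)) L (IsCMField.complexConj L) 3) (_ : Nonempty 𝔓.ι)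
      (μω : HeckeCharacter L) (hμu : μω.IsUnitary),
      (∀ x : Literature.NumberTheory.GaloisRepresentations.ideleGroup ↥(maximalRealSubfield L),
        μω (AdeleRing.ideleBaseChange (↥(maximalRealSubfield L)) L x) = quadraticHeckeCharCM L x) →
      ∀ (ξ : OneDimAutRepH L), LHalfNeZero (ξ.bcη⁻¹ * μω) →
        ∃ P : DiscreteAutomorphicRep (quasiSplit (↥(maximalRealSubfield L)) L (IsCMField.complexConj L) 3) μ,
          (∃ Pv : ∀ v : HeightOneSpectrum (𝓞 ↥(maximalRealSubfield L)), CMLocalAPacket L ((StdForm.antidiagonal 3).over L) v,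
            ξ.IsXiLocalFamily (UnitaryGroup.cmConj_antidiagonal_transpose L 3)
                ((Matrix.isUnit_iff_isUnit_det _).mp (StdForm.isUnit_over (StdForm.antidiagonal 3) L)) μω hμu Pv ∧
            LocalConstituentsIn P Pv ∧
            ∀ v : HeightOneSpectrum (𝓞 ↥(maximalRealSubfield L)),
              (∀ w : PlacesOver L v, IsCMField.complexConj L • w.1 = w.1) →
              ∀ c : IrrClass ((quasiSplit (↥(maximalRealSubfield L)) L (IsCMField.complexConj L) 3).Local v), c ∈ (Pv v).members →
                ¬ c.IsSupercuspidal ∧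
                ∀ [MeasurableSpace ((quasiSplit (↥(maximalRealSubfield L)) L (IsCMField.complexConj L) 3).Local v ⧸
                      Subgroup.center ((quasiSplit (↥(maximalRealSubfield L)) L (IsCMField.complexConj L) 3).Local v))]
                  [BorelSpace ((quasiSplit (↥(maximalRealSubfield L)) L (IsCMField.complexConj L) 3).Local v ⧸
                      Subgroup.center ((quasiSplit (↥(maximalRealSubfield L)) L (IsCMField.complexConj L) 3).Local v))]
                  (μZ : Measure ((quasiSplit (↥(maximalRealSubfield L)) L (IsCMField.complexConj L) 3).Local v ⧸
                      Subgroup.center ((quasiSplit (↥(maximalRealSubfield L)) L (IsCMField.complexConj L) 3).Local v)))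
                  [μZ.IsHaarMeasure], ¬ c.IsSquareIntegrable μZ) ∧
          P.space ≤ residualSubspace (quasiSplit (↥(maximalRealSubfield L)) L (IsCMField.complexConj L) 3) μ 𝔓) :
    ∀ (L : Type) [Field L] [NumberField L] [IsCMField L]
      (μ : Measure (UnitaryGroup.cmDatum L 3 (qsForm L)).automorphicQuotient) [(UnitaryGroup.cmDatum L 3 (qsForm L)).IsAutomorphicMeasure μ]
      (μω : HeckeCharacter L) (hμu : μω.IsUnitary),
      (∀ x : Literature.NumberTheory.GaloisRepresentations.ideleGroup ↥(maximalRealSubfield L),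
        μω (AdeleRing.ideleBaseChange (↥(maximalRealSubfield L)) L x) = quadraticHeckeCharCM L x) →
      ∀ (ξ : OneDimAutRepH L), LHalfNeZero (ξ.bcη⁻¹ * μω) →
        ∃ P : DiscreteAutomorphicRep (UnitaryGroup.cmDatum L 3 (qsForm L)) μ, IsPiN P μω hμu ξ ∧ P.space ≤ cmResidualSubspaceR L 3 μ := by
  intro L _ _ _ μ _ μω hμu hμω ξ hL
  haveI : (adelicGroupData (↥(maximalRealSubfield L)) L (IsCMField.complexConj L) 3
      (Matrix.of fun i j : Fin 3 => if i.val + j.val + 1 = 3 then (1 : L) else 0)).IsAutomorphicMeasure μ :=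
    ‹(UnitaryGroup.cmDatum L 3 (qsForm L)).IsAutomorphicMeasure μ›
  have hrad : ∀ j : (cmParabolicDataR L 3).ι, (cmParabolicDataR L 3).radical j =
      (flagUnipotentRadical 3 1 (AdeleRing (𝓞 L) L)).comap
        (adelicVal (↥(maximalRealSubfield L)) L (IsCMField.complexConj L) 3 (Matrix.of fun i j : Fin 3 => if i.val + j.val + 1 = 3 then (1 : L) else 0)) := by
    rintro ⟨k, hk1, hk2⟩
    have hk : k = 1 := by omega
    subst hk
    rfl
  exact resG_piN_occurs_of_eq_of_nonempty (H L) (antidiagOne_eq_over L 3).symm (antidiagOne_isHermitian L 3) (isUnit_antidiagOne_det L 3) μ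
    (cmParabolicDataR L 3) hrad ⟨⟨1, by norm_num, by norm_num⟩⟩ μω hμu hμω ξ hL

end Summit.HodgeConjecture.HodgeConjecture.R90.S8

end
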